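import Mathlib
import HarnessLib
import Summits.HubbardSuperconductivity.HubbardSuperconductivity.Theorems.KLProgrammeKLRegimeEngineTowerInstProfileLev
import Summits.HubbardSuperconductivity.HubbardSuperconductivity.Theorems.KLProgrammeKLRegimeEngineTowerBlockIncrLevKit

/-!
# Route `KLProgramme` — crux K3 ENGINE (stmt-HubbardSuperconductivity-20437 `KLRegimeEngineV17F2`), stub (b) v2, THE LEVELS PACKAGE (ℓ), instantiation (I2)/(I3):
# THE UV DATUM OF THE LEVELLED PROFILE FROM THE LEVEL-ZERO PACKAGE `KernelNormsLevels … K 0` (cell gate-hubbard-kl, seat p4 g18)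

`klTowerMuLev_le_profile` (…InstProfileLev) reads the UV datum through bounds `N₀ t p` on the level-0 carriers `klAnisoLegKernelNormAt … klE0 0 (2p) Ωe′`
(`levelCount Ωe′ = t + 1`) and a UV law `N₀ t p / klLevUnit … t p 0 ≤ A_uv λ^{p−1} Q_uv^p`.  Here the datum is taken to be the measured level-zero array itself,
`N₀ t p := klTowerMeasLev … d 0 (2p) (t+1)` (block `0`: input `𝒱_0[K]`, family `F_0`), and the UV law is read off the level-zero package
`KernelNormsLevels L M P Qe β U μ K 0` (…ScaleZeroLevelZeroFrame supplies it at every admissible frame): at `n = 0` every level gain is `1`, so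
`klTowerMeasLev … d 0 (2p) F ≤ Qe.CE^p·ε₀^{p−1}` (`ε₀ = epsCoupling P U 0 = Klam·|U|`), and `klLevUnit … t p 0 = ε_x^{2p−1}` (`ε_x = imagTimeWeight β M`) turns it into
`ε_x·ε₀^{p−1}·(Qe.CE/ε_x²)^p`.

* §1 `klAnisoLegKernelNormAt_le_klTowerMeasLev_zero`, `klTowerMeasLev_zero_le_of_kernelNormsLevels`, `klLevUnit_zero`, `uvLaw_div_klLevUnit_zero_le`;
* §2 **`klTowerMuLev_le_profile_of_levelZero`** — the track-blind profile (`m ≥ 4`) and the six-leg import modulo the located cell «(I2)-F1-HMU», with the UV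
  hypotheses DISCHARGED from `KernelNormsLevels … K 0` and `epsCoupling P U 0 ≤ λ`: `A_uv = ε_x`, `Q_uv = Qe.CE/ε_x²`.
Compositions of landed theorems and real algebra; nothing about the model is asserted beyond them; nothing asserts (ℓ), any stub, K3 or superconductivity.
References: BGM 2006 §2.8 (2.83), (2.93)–(2.98), Lemma 2.5 (2.98) [cite: BenfattoGiulianiMastropietro2006].
-/

noncomputable section

namespace Summit.HubbardSuperconductivity.HubbardSuperconductivity.Theorems.EngineV8

set_option linter.dupNamespace false -- summit = problem name (single-conjunct summit), D-0017

open Classical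
open Real Finset Literature.MathematicalPhysics.QuantumLattice Literature.Probability.LatticeModels GrassmannAlgebra
open Literature.MathematicalPhysics.QuantumLattice.FermiRG
open Summit.HubbardSuperconductivity.HubbardSuperconductivity.Theorems.KLProgrammeLegKernels
open Summit.HubbardSuperconductivity.HubbardSuperconductivity.Theorems.KLRegimeSplit
open Summit.HubbardSuperconductivity.HubbardSuperconductivity.Theorems.KLRegimeWick
open Summit.HubbardSuperconductivity.HubbardSuperconductivity.Theorems.TorusFourierL2
open Summit.HubbardSuperconductivity.HubbardSuperconductivity.Theorems.DispersionFlow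
open Summit.HubbardSuperconductivity.HubbardSuperconductivity.Theorems.PerturbedFermiCurve

variable {L M : ℕ} [NeZero L] [NeZero M]

/-! ## §1 The level-zero measured array bounds the level-0 carriers, and the level-zero package bounds it -/

omit [NeZero M] in
/-- Every level-0 carrier of level `t + 1` is at most the block-`0` measured levelled array (input `𝒱_0[K]`, family `F_0 = F_{d·0−1}`). -/
theorem klAnisoLegKernelNormAt_le_klTowerMeasLev_zero (β U μ : ℝ) (K : TrigPolyC4v) (d : ℕ) (t : Fin 5) (p : ℕ)
    (Ωe' : Fin (2 * p) → Option (SectorLeg (sectorCount 0))) (hlev : levelCount Ωe' = (t : ℕ) + 1) :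
    klAnisoLegKernelNormAt L M β U μ K klE0 0 (2 * p) Ωe' ≤ klTowerMeasLev L M β U μ K d 0 (2 * p) ((t : ℕ) + 1) := by
  have hlev' : @levelCount (sectorCount (d * 0 - 1)) (2 * p) Ωe' = (t : ℕ) + 1 := hlev
  have h := klLevNormOf_le_klTowerMeasLev (L := L) (M := M) β U μ K d 0 (2 * p) Ωe'
  rw [hlev'] at h
  exact h

omit [NeZero M] in
/-- **The level-zero package bounds the block-`0` measured levelled array**: `KernelNormsLevels … K 0` ⇒ for `p ≥ 3` and every level count `F`,
`klTowerMeasLev … d 0 (2p) F ≤ Qe.CE^p·(epsCoupling P U 0)^{p−1}` (at `n = 0` the scale and level factors are `1`). [cite: BenfattoGiulianiMastropietro2006, Lemma 2.5 (2.98)] -/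
theorem klTowerMeasLev_zero_le_of_kernelNormsLevels {P : SplitConsts} {Qe : EngConsts} {β U μ : ℝ} {K : TrigPolyC4v}
    (h0 : KernelNormsLevels L M P Qe β U μ K 0) (hCE : 0 ≤ Qe.CE) (hε : 0 ≤ epsCoupling P U 0) (d : ℕ) {p : ℕ} (hp : 3 ≤ p) (F : ℕ) :
    klTowerMeasLev L M β U μ K d 0 (2 * p) F ≤ Qe.CE ^ p * epsCoupling P U 0 ^ (p - 1) := by
  have hR : 0 ≤ Qe.CE ^ p * epsCoupling P U 0 ^ (p - 1) := by positivity
  unfold klTowerMeasLev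
  rcases isEmpty_or_nonempty {Ωe : Fin (2 * p) → Option (SectorLeg (sectorCount (d * 0 - 1))) // levelCount Ωe = F} with h | h
  · rw [Real.iSup_of_isEmpty]; exact hR
  · refine ciSup_le fun Ωe => ?_
    have h1 := h0 p hp Ωe.1
    simp only [Nat.cast_zero, mul_zero, zpow_zero, pow_zero, inv_one, one_pow, mul_one] at h1
    exact h1

omit [NeZero L] [NeZero M] in
/-- The unit at family `0` is `ε_x^{2p−1}`. -/
theorem klLevUnit_zero (β : ℝ) (M : ℕ) (t : Fin 5) (p : ℕ) : klLevUnit β M t p 0 = imagTimeWeight β M ^ (2 * p - 1) := by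
  unfold klLevUnit; simp

omit [NeZero L] in
/-- **The UV law in kit units**: `Qe.CE^p ε₀^{p−1} / klLevUnit … t p 0 ≤ ε_x·λ^{p−1}·(Qe.CE/ε_x²)^p` for `p ≥ 1`, `0 ≤ ε₀ ≤ λ`, `ε_x = imagTimeWeight β M > 0`. -/
theorem uvLaw_div_klLevUnit_zero_le {β : ℝ} (hβ : 0 < β) {CE ε₀ lam : ℝ} (hCE : 0 ≤ CE) (hε0 : 0 ≤ ε₀) (hεl : ε₀ ≤ lam) (t : Fin 5)
    {p : ℕ} (hp : 1 ≤ p) :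
    CE ^ p * ε₀ ^ (p - 1) / klLevUnit β M t p 0 ≤
      imagTimeWeight β M * lam ^ (p - 1) * (CE / imagTimeWeight β M ^ 2) ^ p := by
  have hx : 0 < imagTimeWeight β M := by
    unfold imagTimeWeight
    have : (0 : ℝ) < M := Nat.cast_pos.2 (Nat.pos_of_ne_zero (NeZero.ne M))
    positivity
  rw [klLevUnit_zero]
  have heq : CE ^ p * ε₀ ^ (p - 1) / imagTimeWeight β M ^ (2 * p - 1) = imagTimeWeight β M * ε₀ ^ (p - 1) * (CE / imagTimeWeight β M ^ 2) ^ p := by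
    set n := 2 * p - 1 with hn
    have h2p : 2 * p = n + 1 := by omega
    rw [div_pow, ← pow_mul, h2p, pow_succ]
    field_simp
  rw [heq]
  have : ε₀ ^ (p - 1) ≤ lam ^ (p - 1) := pow_le_pow_left₀ hε0 hεl _
  have h0 : 0 ≤ (CE / imagTimeWeight β M ^ 2) ^ p := by positivity
  exact mul_le_mul_of_nonneg_right (mul_le_mul_of_nonneg_left this hx.le) h0

/-! ## §2 The levelled profile with the UV datum discharged from the level-zero package -/

omit [NeZero L] [NeZero M] in
/-- **THE TRACK-BLIND LEVELLED PROFILE, UV DATUM FROM `KernelNormsLevels … K 0`.**  Under the binders of `klTowerMuLev_le_profile`, with the level-zero package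
`KernelNormsLevels L M P Qe β U μ K 0` (`0 ≤ Qe.CE`), a law parameter `λ ≥ epsCoupling P U 0`, and the law `klTowerBLev … d t k′ p ≤ A λ^{p−1} Q^p` on the blocks
`1 ≤ k′ ≤ k`: (a) `klTowerMuLev … d k m ≤ A′ λ^{m−1} Q′^m` for every `m ≥ 4`; (b) `klTowerMuLevAt … d 0 k 3 ≤ X → klTowerMuLev … d k 3 ≤ max X (A′ λ² Q′³)`;
`A′ = 27⁵(C₁/C₂)(ε_x + A/(1 − ((√2)^d)⁻¹))`, `Q′ = C₂²·max Q (Qe.CE/ε_x²)`, `ε_x = imagTimeWeight β M`.  [cite: BenfattoGiulianiMastropietro2006, §2.8 (2.83), (2.93)-(2.98)] -/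
theorem klTowerMuLev_le_profile_of_levelZero :
    ∃ C₁ C₂ : ℝ, 0 < C₁ ∧ 0 < C₂ ∧ ∀ R : RenConsts, R.WF2 → ∃ c₃' : ℝ, 0 < c₃' ∧ ∃ U₀' : ℝ, 0 < U₀' ∧
      ∀ (P : SplitConsts) (c : ℝ), P.WF → 0 < c → c ≤ klEngC₃6 P R → c ≤ c₃' →
      ∀ μ ∈ klWindowC, ∀ U : ℝ, 0 < U → U ≤ klEngU₀9 P R c → U ≤ U₀' → ∀ β : ℝ, klBetaMin ≤ β → β ≤ Real.exp (c / U ^ 2) →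
      ∀ K : TrigPolyC4v, FrameOK R U (nScales β) μ K → ∀ (L M : ℕ) [NeZero L] [NeZero M],
      klEngL₃ β U ≤ L → klEngM₃ β U L ≤ M → ∀ d k : ℕ, 2 ≤ d → 1 ≤ k → d * k - 1 ≤ nScales β + 1 →
      ∀ (Qe : EngConsts), 0 ≤ Qe.CE → KernelNormsLevels L M P Qe β U μ K 0 →
      ∀ (A lam Q : ℝ), 0 ≤ A → 0 ≤ Q → epsCoupling P U 0 ≤ lam →
        (∀ k' : ℕ, 1 ≤ k' → k' ≤ k → ∀ (t : Fin 5) (p : ℕ), 3 ≤ p → klTowerBLev L M β U μ K d t k' p ≤ A * lam ^ (p - 1) * Q ^ p) →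
      (∀ m : ℕ, 4 ≤ m →
        klTowerMuLev L M β U μ K d k m ≤
          (27 : ℝ) ^ 5 * (C₁ / C₂) * (imagTimeWeight β M + A / (1 - (Real.sqrt 2 ^ d)⁻¹)) * lam ^ (m - 1) *
            (C₂ ^ 2 * max Q (Qe.CE / imagTimeWeight β M ^ 2)) ^ m) ∧
      (∀ X : ℝ, klTowerMuLevAt L M β U μ K d 0 k 3 ≤ X →
        klTowerMuLev L M β U μ K d k 3 ≤
          max X ((27 : ℝ) ^ 5 * (C₁ / C₂) * (imagTimeWeight β M + A / (1 - (Real.sqrt 2 ^ d)⁻¹)) * lam ^ 2 *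
            (C₂ ^ 2 * max Q (Qe.CE / imagTimeWeight β M ^ 2)) ^ 3)) := by
  obtain ⟨C₁, C₂, hC₁, hC₂, h⟩ := klTowerMuLev_le_profile
  refine ⟨C₁, C₂, hC₁, hC₂, fun R hR2 => ?_⟩
  obtain ⟨c₃, hc₃, U₀, hU₀, h'⟩ := h R hR2
  refine ⟨c₃, hc₃, U₀, hU₀, ?_⟩
  intro P c hP hc hc6 hc₃' μ hμ U hU hU9 hU₀' β hβmin hβc K hK L M _ _ hL3 hM3 d k hd hk1 hkN Qe hCE h0 A lam Q hA hQ hεl hIH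
  have hβ : 0 < β := KLRegimeSplit.pos_of_klBetaMin_le hβmin
  have hK0 : 0 ≤ P.Klam := le_trans zero_le_one hP.1
  have hε0 : 0 ≤ epsCoupling P U 0 := by unfold epsCoupling; positivity
  have hlam : 0 ≤ lam := hε0.trans hεl
  have hx : 0 < imagTimeWeight β M := by
    unfold imagTimeWeight
    have : (0 : ℝ) < M := Nat.cast_pos.2 (Nat.pos_of_ne_zero (NeZero.ne M))
    positivity
  have hQuv : 0 ≤ Qe.CE / imagTimeWeight β M ^ 2 := by positivity
  exact h' P c hP hc hc6 hc₃' μ hμ U hU hU9 hU₀' β hβmin hβc K hK L M hL3 hM3 d k hd hk1 hkN A lam Q (imagTimeWeight β M)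
    (Qe.CE / imagTimeWeight β M ^ 2) hA hlam hQ hx.le hQuv (fun t p => klTowerMeasLev L M β U μ K d 0 (2 * p) ((t : ℕ) + 1))
    (fun t p => klTowerMeasLev_nonneg hβ.le U μ K d 0 (2 * p) _)
    (fun t p Ωe' hlev => klAnisoLegKernelNormAt_le_klTowerMeasLev_zero β U μ K d t p Ωe' hlev)
    (fun t p hp => (div_le_div_of_nonneg_right (klTowerMeasLev_zero_le_of_kernelNormsLevels h0 hCE hε0 d hp _) (klLevUnit_pos hβ t p 0).le).trans
      (uvLaw_div_klLevUnit_zero_le hβ hCE hε0 hεl t (by omega)))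
    hIH

end Summit.HubbardSuperconductivity.HubbardSuperconductivity.Theorems.EngineV8

end
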